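import Mathlib
import Summits.ValiantsHypothesis.ValiantsHypothesis.Theorems.SoloInformedMultivariateWindow
import Summits.ValiantsHypothesis.ValiantsHypothesis.Theorems.SoloInformedPolynomialWindow
import HarnessLib

/-!
# The multivariate window form on FEW variables: `n ≤ s^{1/c₀}` suffices
(solo seat `solo-ValiantsHypothesis-informed`, s29)

`SoloInformedMultivariateWindow` certifies (Q*-mult) ⟹ `VP ℂ ≠ VNP ℂ`: a bound `m ≤ C' s^γ`, `γ < 3/2`,
on the size `m` of every set family on `Fin n` — ANY `n` — that is independent to order `Kf s` and realised
in the quadratic span of `s` algebraic functions of `x_1, …, x_n`.  In Raz's regime the number of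
variables is tiny against the arity: `s(n) = n^{2ρ(n)+τ(n)}` with `τ(n) → ∞`.  This file records the
corresponding weakening of the hypothesis, at no cost in the conclusion: for any fixed `c₀`, the bound is
needed only for families on `n` variables with `n^{c₀} ≤ s`
(`soloInformed_valiantsHypothesis_of_multWindowBound_fewVars`; log-order instance
`…_of_multLogOrderBound_fewVars`).  So the summit follows from a statement about `s` algebraic
functions of `n ≤ s^ε` variables (any fixed `ε > 0`) whose pairwise products span super-`s^{3/2-δ}` many
multilinear monomials with order-`(log s)`-independent exponent vectors.  The hypothesis is OPEN; only
the implication is claimed.  Also recorded: the arithmetic passage from a real-exponent bound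
`m ≤ C s^γ`, `γ < 3/2`, to a natural-exponent bound `m^b ≤ c s^a`, `2a < 3b`, is imported from
`SoloInformedPolynomialWindow` (`soloPoly_rpow_to_exponent`).
References: R. Raz, Elusive functions and lower bounds for arithmetic circuits, Theory of Computing 6
(2010), Cor. 5.8 [Raz2010]; Garg–Makam–Oliveira–Wigderson, FOCS 2019, Lemma 9.3
[GargMakamOliveiraWigderson2019].
-/

noncomputable section

open MvPolynomial Finset

namespace Summit.ValiantsHypothesis.ValiantsHypothesis.Theorems

open Literature.Computability.AlgebraicComplexity

/-- **Multivariate window form on few variables, exponent version.**  As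
`soloInformed_vp_ne_vnp_of_multWindowBound_exponent`, but the bound `m^b ≤ c · s^a` is required only
for set families on `n` variables with `n^{c₀} ≤ s`, for a fixed `c₀` of the user's choice.
[cite: Raz2010, Cor. 5.8 = Cor. 1.14, Defs. 1.1, 1.3] -/
theorem soloInformed_vp_ne_vnp_of_multWindowBound_fewVars (Kf : ℕ → ℕ)
    {Cexp s₁ : ℕ} (hKf : ∀ s, s₁ ≤ s → Kf s ≤ (Nat.log 2 s + 2) ^ Cexp) (c₀ : ℕ)
    {a b c s₀ : ℕ} (hab : 2 * a < 3 * b)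
    (hQ : ∀ s : ℕ, s₀ ≤ s → ∀ (n m : ℕ) (S : Fin m → Finset (Fin n)), n ^ c₀ ≤ s →
      SoloIndep (Kf s) S → ∀ g : Fin s → SoloΩn n, SoloRealisedFamily g S → m ^ b ≤ c * s ^ a) :
    VP ℂ ≠ VNP ℂ := by
  obtain ⟨n₀, hn₀⟩ := qw_eventually a b c Kf hKf
  refine soloInformed_vp_ne_vnp_of_multWindow_pointwise (r := qwR a b c Kf) (s := qwS a b c)
    (fun n => (qwDesign a b c Kf (fun _ => 1) n).S) ?_ ?_ ?_
    (qw_isPolyDefinableMap a b c Kf fun _ => 1)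
  · refine ⟨n₀, fun n hn => ?_⟩ -- Raz's parameter conditions `3 ≤ r ≤ n ≤ s`
    obtain ⟨hn1, hf, hW⟩ := hn₀ n hn
    have hr : qwR a b c Kf n = 3 * qwRho a b c n := if_pos hf
    have hWge := qwW_ge a b c (qwTau a b c n)
    have hρ : qwRho a b c n = a * qwTau a b c n + 1 := rfl
    refine ⟨?_, ?_, ?_⟩
    · rw [hr, hρ]; omega
    · rw [hr, hρ]; exact hWge.2.1.trans (hW.trans (Nat.log_le_self 2 n))
    · exact Nat.le_self_pow (by rw [hρ]; omega) n
  · intro c₁ -- growth: `n^{c₁} · C(n + 2ρ - 1, 2ρ) ≤ n^{c₁ + 2ρ} ≤ n^{2ρ + τ} = s`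
    refine ⟨max n₀ (2 ^ qwW a b c c₁), fun n hn => ?_⟩
    obtain ⟨hn1, hf, -⟩ := hn₀ n ((le_max_left _ _).trans hn)
    have hr : qwR a b c Kf n = 3 * qwRho a b c n := if_pos hf
    have hτ : c₁ ≤ qwTau a b c n :=
      le_qwTau a b c (Nat.le_log_of_pow_le one_lt_two ((le_max_right _ _).trans hn))
    rw [hr, show 2 * (3 * qwRho a b c n) / 3 = 2 * qwRho a b c n by omega]
    unfold qwS
    calc n ^ c₁ * Nat.choose (n + 2 * qwRho a b c n - 1) (2 * qwRho a b c n)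
        ≤ n ^ c₁ * n ^ (2 * qwRho a b c n) :=
          Nat.mul_le_mul_left _ (choose_multiset_le_pow hn1 _)
      _ = n ^ (c₁ + 2 * qwRho a b c n) := (pow_add _ _ _).symm
      _ ≤ n ^ (2 * qwRho a b c n + qwTau a b c n) := Nat.pow_le_pow_right hn1 (by omega)
  · -- the bound beats the arity; the design lives on `n ≤ s^{1/c₀}` variables once `τ ≥ c₀`
    refine ⟨max (max n₀ s₀) (2 ^ qwW a b c c₀), fun n hn g hreal => ?_⟩
    have hn' : max n₀ s₀ ≤ n := (le_max_left _ _).trans hn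
    obtain ⟨hn1, hf, hW⟩ := hn₀ n ((le_max_left _ _).trans hn')
    have hr : qwR a b c Kf n = 3 * qwRho a b c n := if_pos hf
    have hWge := qwW_ge a b c (qwTau a b c n)
    have hlog : Nat.log 2 n < n := Nat.log_lt_self 2 (by omega)
    have hs₀ : s₀ ≤ qwS a b c n :=
      ((le_max_right _ _).trans hn').trans (Nat.le_self_pow (by unfold qwRho; omega) n)
    have hτc : c₀ ≤ qwTau a b c n :=
      le_qwTau a b c (Nat.le_log_of_pow_le one_lt_two ((le_max_right _ _).trans hn))
    have hnc : n ^ c₀ ≤ qwS a b c n := by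
      unfold qwS
      exact Nat.pow_le_pow_right hn1 (by omega)
    have hQ' := hQ _ hs₀ n _ (qwDesign a b c Kf (fun _ => 1) n).S hnc
      (qwDesign_soloIndep a b c Kf (fun _ => 1) n) g hreal
    rw [hr] at hQ'
    unfold qwS qwRho at hQ'
    set τ := qwTau a b c n with hτdef
    obtain ⟨d₁, hd₁⟩ : ∃ d₁, 3 * b = 2 * a + 1 + d₁ := ⟨3 * b - (2 * a + 1), by omega⟩
    have hident : (2 * (a * τ + 1) + τ) * a + (a * τ * d₁ + d₁ + 1) = 3 * (a * τ + 1) * b := by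
      rw [show 3 * (a * τ + 1) * b = (a * τ + 1) * (3 * b) by ring, hd₁]; ring
    have h1 : n ^ (3 * (a * τ + 1)) ≤
        Nat.factorial (3 * (a * τ + 1)) * Nat.choose (n + 3 * (a * τ + 1) - 1) (3 * (a * τ + 1)) :=
      solo_pow_le_factorial_mul_choose_multiset n _
    have h2 : n ^ (3 * (a * τ + 1) * b) ≤
        Nat.factorial (3 * (a * τ + 1)) ^ b * (c * (n ^ (2 * (a * τ + 1) + τ)) ^ a) :=
      calc n ^ (3 * (a * τ + 1) * b) = (n ^ (3 * (a * τ + 1))) ^ b := pow_mul _ _ _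
        _ ≤ (Nat.factorial (3 * (a * τ + 1)) *
              Nat.choose (n + 3 * (a * τ + 1) - 1) (3 * (a * τ + 1))) ^ b :=
            Nat.pow_le_pow_left h1 _
        _ = Nat.factorial (3 * (a * τ + 1)) ^ b *
              Nat.choose (n + 3 * (a * τ + 1) - 1) (3 * (a * τ + 1)) ^ b := mul_pow _ _ _
        _ ≤ Nat.factorial (3 * (a * τ + 1)) ^ b * (c * (n ^ (2 * (a * τ + 1) + τ)) ^ a) :=
            Nat.mul_le_mul_left _ hQ'
    have h3 : n ^ ((2 * (a * τ + 1) + τ) * a) * n ≤ n ^ (3 * (a * τ + 1) * b) := by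
      rw [← hident, pow_add]; exact Nat.mul_le_mul_left _ (Nat.le_self_pow (by omega) n)
    have h4 : n ^ ((2 * (a * τ + 1) + τ) * a) * n ≤
        n ^ ((2 * (a * τ + 1) + τ) * a) * (Nat.factorial (3 * (a * τ + 1)) ^ b * c) :=
      calc n ^ ((2 * (a * τ + 1) + τ) * a) * n ≤ n ^ (3 * (a * τ + 1) * b) := h3
        _ ≤ Nat.factorial (3 * (a * τ + 1)) ^ b * (c * (n ^ (2 * (a * τ + 1) + τ)) ^ a) := h2
        _ = n ^ ((2 * (a * τ + 1) + τ) * a) * (Nat.factorial (3 * (a * τ + 1)) ^ b * c) := by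
            rw [← pow_mul]; ring
    have h5 : n ≤ Nat.factorial (3 * (a * τ + 1)) ^ b * c :=
      Nat.le_of_mul_le_mul_left h4 (by positivity)
    have h6 : c * Nat.factorial (3 * (a * τ + 1)) ^ b < n :=
      lt_of_le_of_lt (hWge.2.2.2.trans hW) hlog
    linarith [h5, h6]

/-- **(Q*-mult on few variables) ⟹ Valiant's hypothesis.**  Fix any `c₀` and any order function
`Kf s ≤ (⌊log₂ s⌋ + 2)^C` (eventually).  If for all large `s`, every set family `S_1, …, S_m ⊂ Fin n`
with `n^{c₀} ≤ s` that is independent to order `Kf s` and realised in the quadratic span of `s` algebraic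
functions of `x_1, …, x_n` has `m ≤ C' · s^γ` for a real `γ < 3/2`, then `ValiantsHypothesis`.  The
hypothesis is open; only the implication is claimed.
[cite: Raz2010, Cor. 5.8 = Cor. 1.14; GargMakamOliveiraWigderson2019, Lemma 9.3] -/
theorem soloInformed_valiantsHypothesis_of_multWindowBound_fewVars (Kf : ℕ → ℕ)
    {Cexp s₁ : ℕ} (hKf : ∀ s, s₁ ≤ s → Kf s ≤ (Nat.log 2 s + 2) ^ Cexp) (c₀ : ℕ)
    {γ C : ℝ} (hγ : γ < 3 / 2) {s₀ : ℕ}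
    (hQ : ∀ s : ℕ, s₀ ≤ s → ∀ (n m : ℕ) (S : Fin m → Finset (Fin n)), n ^ c₀ ≤ s →
      SoloIndep (Kf s) S → ∀ g : Fin s → SoloΩn n, SoloRealisedFamily g S →
        (m : ℝ) ≤ C * (s : ℝ) ^ γ) :
    ValiantsHypothesis := by
  obtain ⟨a, b, c, hab, hconv⟩ := soloPoly_rpow_to_exponent (C := C) hγ
  refine soloInformed_vp_ne_vnp_of_multWindowBound_fewVars Kf hKf c₀ (a := a) (b := b) (c := c)
    (s₀ := max s₀ 1) hab fun s hs n m S hn hind g hreal => ?_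
  exact hconv s m ((le_max_right _ _).trans hs)
    (hQ s ((le_max_left _ _).trans hs) n m S hn hind g hreal)

/-- **(VB-log-mult on few variables) ⟹ Valiant's hypothesis.**  For any fixed `c₀`: if for some real
`γ < 3/2` and `C`, for all large `s`, every set family `S_1, …, S_m` of subsets of `Fin n` with
`n^{c₀} ≤ s`, whose indicator vectors satisfy no nontrivial integer relation with at most `⌊log₂ s⌋ + 2`
terms, and whose monomials `x^{S_i}` lie in the quadratic span of `s` algebraic functions of
`x_1, …, x_n`, has `m ≤ C · s^γ`, then `VP ℂ ≠ VNP ℂ`.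
[cite: Raz2010, Cor. 5.8 = Cor. 1.14; GargMakamOliveiraWigderson2019, Lemma 9.3] -/
theorem soloInformed_valiantsHypothesis_of_multLogOrderBound_fewVars (c₀ : ℕ) {γ C : ℝ}
    (hγ : γ < 3 / 2) {s₀ : ℕ}
    (hQ : ∀ s : ℕ, s₀ ≤ s → ∀ (n m : ℕ) (S : Fin m → Finset (Fin n)), n ^ c₀ ≤ s →
      SoloIndep (Nat.log 2 s + 2) S → ∀ g : Fin s → SoloΩn n, SoloRealisedFamily g S →
        (m : ℝ) ≤ C * (s : ℝ) ^ γ) :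
    ValiantsHypothesis :=
  soloInformed_valiantsHypothesis_of_multWindowBound_fewVars (fun s => Nat.log 2 s + 2) (Cexp := 1)
    (s₁ := 0) (fun s _ => by rw [pow_one]) c₀ hγ hQ

end Summit.ValiantsHypothesis.ValiantsHypothesis.Theorems

end
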